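import Mathlib

/-!
# Forced tangency: the drift of a bounded function with divergent, comparable, asymptotically
# parallel gradient along a Lipschitz path

Support file for item `RussoDrift` (stmt-CriticalPhenomena-10271) of route `CardySelfRefinement`
(sub-problem `CriticalPhenomena/CardyFormulaZ2`): the real-analysis core of the "forced tangency"
step (idea card `z2-interpolates-to-itself`, P2), in abstract form.

Setting: a path `γ : ℝ → ℝ × ℝ` with `1`-Lipschitz coordinates (the RSW path reparametrised by
total variation, see `CardySelfRefinementRussoDriftReparam`), a measurable field of unit vectors
`u` along it, and a family `Φ η : ℝ × ℝ → ℝ` of `C¹` functions (`η ∈ (0, η₀)`; the joint crossing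
probability as a polynomial in `(ρ, c)`) with `Φ η ∘ γ ∈ [0,1]`, whose gradient `g = (g₁, g₂)` along
the path is (T) parallel to `u` up to an absolute error `ε(η) → 0`, (C) comparable in size between
any two path points, (D) uniformly divergent, and (S) has tangential component `g · u` of constant
sign.  Conclusion (`tendsto_sub_of_forced_tangency`): `Φ η (γ L) − Φ η (γ 0) → 0` as `η → 0⁺`.

Proof.  By Rademacher/Lebesgue (`LipschitzWith.ae_differentiableAt_real`) and the FTC for absolutely
continuous functions (`AbsolutelyContinuousOnInterval.integral_deriv_eq_sub`),
`Φ(γ b) − Φ(γ a) = ∫_a^b ∇Φ(γ)·γ'`; decomposing in the orthonormal frame `(u, u^⊥)`,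
`∇Φ·γ' = (g·u)(u·γ') + (g·u^⊥)(u^⊥·γ')` with `|g·u^⊥| ≤ ε`, so
`|Φ(γ b) − Φ(γ a) − ∫_a^b λ w| ≤ 2ε(b − a)` with `λ = g·u`, `w = u·γ'`
(`abs_sub_sub_integral_le`).  The tangential speed `w` vanishes a.e. on `(0, L)`
(`ae_nonpos_of_forced_tangency`, applied to `u` and `−u`): at a Lebesgue point `t₀` of `w⁺` and `w⁻`
with `w(t₀) > 0` (`LocallyIntegrable.ae_hasDerivAt_integral`), on a short interval `[t₀, b]` the
weight `λ` has constant sign and values in `[m, 2Λ² m]`, so `|∫ λ w| ≥ m · w(t₀) (b − t₀)/4`, while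
`|∫ λ w| ≤ 1 + 2L` because `Φ ∘ γ ∈ [0,1]`; this bounds `m ≍` the gradient size, contradicting (D).
Hence the drift is `≤ 2 ε(η) L → 0`.

Pure real analysis (Mathlib only); the argument is the one sketched in the route item (informal:
"the component along `(κ₁,κ₂)` must vanish as a measure, else a divergent comparable sign-definite
weight integrates to more than `1` on a small interval; the other component contributes
`O(η^θ · Var γ)`").
-/

noncomputable section

open Set Filter Topology MeasureTheory intervalIntegral

namespace Summit.CriticalPhenomena.CardyFormulaZ2.Theorems.RussoDrift

/-- A measurable real function bounded on `[a, b]` is interval integrable on `a..b` (`a ≤ b`).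
(Bookkeeping; folklore.) -/
theorem intervalIntegrable_of_abs_le {f : ℝ → ℝ} (hf : Measurable f) {a b C : ℝ} (hab : a ≤ b)
    (hC : ∀ t ∈ Icc a b, |f t| ≤ C) : IntervalIntegrable f volume a b := by
  have h : IntegrableOn f (uIcc a b) volume := by
    rw [uIcc_of_le hab]
    exact Measure.integrableOn_of_bounded (M := C) measure_Icc_lt_top.ne hf.aestronglyMeasurable
      ((ae_restrict_iff' measurableSet_Icc).2 (Eventually.of_forall fun t ht => by
        rw [Real.norm_eq_abs]; exact hC t ht))
  exact h.intervalIntegrable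

/-- **Chain rule + FTC along a Lipschitz path, in the moving frame `(u, u^⊥)`.**  For `Ψ ∈ C¹`,
`γ` with `1`-Lipschitz coordinates, `u` a measurable unit vector field, `Gᵢ = ∂ᵢΨ ∘ γ`, and
`|u₂ G₁ − u₁ G₂| ≤ e` (the gradient is `e`-parallel to `u`):
`|Ψ(γ b) − Ψ(γ a) − ∫_a^b (u·G)(u·γ')| ≤ 2 e (b − a)`. (Folklore calculus.) -/
theorem abs_sub_sub_integral_le {γ : ℝ → ℝ × ℝ} (hγ₁ : LipschitzWith 1 fun t => (γ t).1)
    (hγ₂ : LipschitzWith 1 fun t => (γ t).2) {Ψ : ℝ × ℝ → ℝ} (hΨ : ContDiff ℝ 1 Ψ)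
    {u : ℝ → ℝ × ℝ} (hum : Measurable u) (hu : ∀ t, (u t).1 ^ 2 + (u t).2 ^ 2 = 1)
    {G₁ G₂ : ℝ → ℝ} (hG₁ : ∀ t, G₁ t = fderiv ℝ Ψ (γ t) (1, 0))
    (hG₂ : ∀ t, G₂ t = fderiv ℝ Ψ (γ t) (0, 1)) {e : ℝ}
    (hT : ∀ t, |(u t).2 * G₁ t - (u t).1 * G₂ t| ≤ e) {a b : ℝ} (hab : a ≤ b) :
    |Ψ (γ b) - Ψ (γ a) - ∫ t in a..b, ((u t).1 * G₁ t + (u t).2 * G₂ t) *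
        ((u t).1 * (deriv γ t).1 + (u t).2 * (deriv γ t).2)| ≤ 2 * e * (b - a) := by
  have hγ : LipschitzWith 1 γ := by simpa using hγ₁.prodMk hγ₂
  have hγc : Continuous γ := hγ.continuous
  -- speed bounds
  have hv : ∀ t, ‖deriv γ t‖ ≤ 1 := fun t => by
    simpa using norm_deriv_le_of_lipschitz (x₀ := t) hγ
  have hv₁ : ∀ t, |(deriv γ t).1| ≤ 1 := fun t =>
    (Real.norm_eq_abs _ ▸ norm_fst_le (deriv γ t)).trans (hv t)
  have hv₂ : ∀ t, |(deriv γ t).2| ≤ 1 := fun t =>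
    (Real.norm_eq_abs _ ▸ norm_snd_le (deriv γ t)).trans (hv t)
  have hu₁ : ∀ t, |(u t).1| ≤ 1 := fun t =>
    (sq_le_one_iff_abs_le_one _).1 (by nlinarith [sq_nonneg (u t).2, hu t])
  have hu₂ : ∀ t, |(u t).2| ≤ 1 := fun t =>
    (sq_le_one_iff_abs_le_one _).1 (by nlinarith [sq_nonneg (u t).1, hu t])
  have he : 0 ≤ e := (abs_nonneg _).trans (hT a)
  -- continuity / measurability
  have hG₁c : Continuous G₁ := by
    rw [show G₁ = fun t => fderiv ℝ Ψ (γ t) (1, 0) from funext hG₁]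
    exact ((hΨ.continuous_fderiv one_ne_zero).comp hγc).clm_apply continuous_const
  have hG₂c : Continuous G₂ := by
    rw [show G₂ = fun t => fderiv ℝ Ψ (γ t) (0, 1) from funext hG₂]
    exact ((hΨ.continuous_fderiv one_ne_zero).comp hγc).clm_apply continuous_const
  have hvm : Measurable (deriv γ) := measurable_deriv γ
  have hv₁m : Measurable fun t => (deriv γ t).1 := measurable_fst.comp hvm
  have hv₂m : Measurable fun t => (deriv γ t).2 := measurable_snd.comp hvm
  have hu₁m : Measurable fun t => (u t).1 := measurable_fst.comp hum
  have hu₂m : Measurable fun t => (u t).2 := measurable_snd.comp hum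
  -- `Ψ ∘ γ` is absolutely continuous on `[a, b]`
  obtain ⟨K, hK⟩ := (hΨ.contDiffOn (s := Metric.closedBall (γ a) (b - a))).exists_lipschitzOnWith
    one_ne_zero (convex_closedBall _ _) (isCompact_closedBall _ _)
  have hmaps : MapsTo γ (Icc a b) (Metric.closedBall (γ a) (b - a)) := by
    intro t ht
    rw [Metric.mem_closedBall]
    calc dist (γ t) (γ a) ≤ 1 * dist t a := by
          have := hγ.dist_le_mul t a; simpa using this
      _ = |t - a| := by rw [one_mul, Real.dist_eq]
      _ ≤ b - a := by rw [abs_of_nonneg (sub_nonneg.2 ht.1)]; linarith [ht.2]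
  have hFlip : LipschitzOnWith (K * 1) (Ψ ∘ γ) (uIcc a b) := by
    rw [uIcc_of_le hab]
    exact hK.comp hγ.lipschitzOnWith hmaps
  have hFac : AbsolutelyContinuousOnInterval (Ψ ∘ γ) a b := hFlip.absolutelyContinuousOnInterval
  have hFTC := hFac.integral_deriv_eq_sub
  -- a.e. chain rule
  have hderiv : ∀ᵐ t, deriv (Ψ ∘ γ) t = G₁ t * (deriv γ t).1 + G₂ t * (deriv γ t).2 := by
    filter_upwards [hγ.ae_differentiableAt_real] with t ht
    have h1 : HasFDerivAt Ψ (fderiv ℝ Ψ (γ t)) (γ t) := (hΨ.differentiable one_ne_zero _).hasFDerivAt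
    have h3 := h1.comp_hasDerivAt t ht.hasDerivAt
    have h4 : deriv γ t = (deriv γ t).1 • ((1 : ℝ), (0 : ℝ)) + (deriv γ t).2 • ((0 : ℝ), (1 : ℝ)) := by
      ext <;> simp
    have h5 : fderiv ℝ Ψ (γ t) (deriv γ t) = (deriv γ t).1 * G₁ t + (deriv γ t).2 * G₂ t := by
      conv_lhs => rw [h4]
      rw [map_add, map_smul, map_smul, smul_eq_mul, smul_eq_mul, ← hG₁ t, ← hG₂ t]
    rw [h3.deriv, h5]
    ring
  -- the moving-frame decomposition of the integrand
  set lam : ℝ → ℝ := fun t => (u t).1 * G₁ t + (u t).2 * G₂ t with hlam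
  set w : ℝ → ℝ := fun t => (u t).1 * (deriv γ t).1 + (u t).2 * (deriv γ t).2 with hw
  set r : ℝ → ℝ := fun t => ((u t).2 * G₁ t - (u t).1 * G₂ t) *
    ((u t).2 * (deriv γ t).1 - (u t).1 * (deriv γ t).2) with hr
  have hdecomp : ∀ t, G₁ t * (deriv γ t).1 + G₂ t * (deriv γ t).2 = lam t * w t + r t := by
    intro t
    simp only [hlam, hw, hr]
    linear_combination (-(G₁ t * (deriv γ t).1 + G₂ t * (deriv γ t).2)) * hu t
  have hrb : ∀ t, |r t| ≤ 2 * e := by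
    intro t
    simp only [hr]
    rw [abs_mul]
    have h2 : |(u t).2 * (deriv γ t).1 - (u t).1 * (deriv γ t).2| ≤ 2 := by
      calc |(u t).2 * (deriv γ t).1 - (u t).1 * (deriv γ t).2|
          ≤ |(u t).2 * (deriv γ t).1| + |(u t).1 * (deriv γ t).2| := abs_sub _ _
        _ = |(u t).2| * |(deriv γ t).1| + |(u t).1| * |(deriv γ t).2| := by rw [abs_mul, abs_mul]
        _ ≤ 1 * 1 + 1 * 1 :=
          add_le_add (mul_le_mul (hu₂ t) (hv₁ t) (abs_nonneg _) zero_le_one)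
            (mul_le_mul (hu₁ t) (hv₂ t) (abs_nonneg _) zero_le_one)
        _ = 2 := by norm_num
    calc |(u t).2 * G₁ t - (u t).1 * G₂ t| * |(u t).2 * (deriv γ t).1 - (u t).1 * (deriv γ t).2|
        ≤ e * 2 := mul_le_mul (hT t) h2 (abs_nonneg _) he
      _ = 2 * e := by ring
  -- bounds on `[a, b]` for integrability
  obtain ⟨C₁, hC₁⟩ := isCompact_Icc.exists_bound_of_continuousOn (hG₁c.continuousOn (s := Icc a b))
  obtain ⟨C₂, hC₂⟩ := isCompact_Icc.exists_bound_of_continuousOn (hG₂c.continuousOn (s := Icc a b))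
  have hlam_m : Measurable lam :=
    (hu₁m.mul hG₁c.measurable).add (hu₂m.mul hG₂c.measurable)
  have hw_m : Measurable w := (hu₁m.mul hv₁m).add (hu₂m.mul hv₂m)
  have hr_m : Measurable r :=
    ((hu₂m.mul hG₁c.measurable).sub (hu₁m.mul hG₂c.measurable)).mul
      ((hu₂m.mul hv₁m).sub (hu₁m.mul hv₂m))
  have hw_b : ∀ t, |w t| ≤ 2 := by
    intro t
    simp only [hw]
    calc |(u t).1 * (deriv γ t).1 + (u t).2 * (deriv γ t).2|
        ≤ |(u t).1 * (deriv γ t).1| + |(u t).2 * (deriv γ t).2| := abs_add_le _ _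
      _ = |(u t).1| * |(deriv γ t).1| + |(u t).2| * |(deriv γ t).2| := by rw [abs_mul, abs_mul]
      _ ≤ 1 * 1 + 1 * 1 :=
          add_le_add (mul_le_mul (hu₁ t) (hv₁ t) (abs_nonneg _) zero_le_one)
            (mul_le_mul (hu₂ t) (hv₂ t) (abs_nonneg _) zero_le_one)
      _ = 2 := by norm_num
  have hlam_b : ∀ t ∈ Icc a b, |lam t| ≤ C₁ + C₂ := by
    intro t ht
    simp only [hlam]
    have h1 := hC₁ t ht
    have h2 := hC₂ t ht
    rw [Real.norm_eq_abs] at h1 h2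
    calc |(u t).1 * G₁ t + (u t).2 * G₂ t| ≤ |(u t).1 * G₁ t| + |(u t).2 * G₂ t| := abs_add_le _ _
      _ = |(u t).1| * |G₁ t| + |(u t).2| * |G₂ t| := by rw [abs_mul, abs_mul]
      _ ≤ 1 * C₁ + 1 * C₂ :=
          add_le_add (mul_le_mul (hu₁ t) h1 (abs_nonneg _) zero_le_one)
            (mul_le_mul (hu₂ t) h2 (abs_nonneg _) zero_le_one)
      _ = C₁ + C₂ := by ring
  have hII_lw : IntervalIntegrable (fun t => lam t * w t) volume a b := by
    refine intervalIntegrable_of_abs_le (hlam_m.mul hw_m) hab (C := (C₁ + C₂) * 2) fun t ht => ?_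
    show |lam t * w t| ≤ (C₁ + C₂) * 2
    rw [abs_mul]
    exact mul_le_mul (hlam_b t ht) (hw_b t) (abs_nonneg _)
      ((abs_nonneg _).trans (hlam_b t ht))
  have hII_r : IntervalIntegrable r volume a b :=
    intervalIntegrable_of_abs_le hr_m hab fun t _ => hrb t
  -- assemble
  have hint1 : ∫ t in a..b, deriv (Ψ ∘ γ) t = ∫ t in a..b, (lam t * w t + r t) := by
    refine integral_congr_ae (hderiv.mono fun t ht _ => ?_)
    rw [ht, hdecomp t]
  have hint2 : ∫ t in a..b, (lam t * w t + r t) = (∫ t in a..b, lam t * w t) + ∫ t in a..b, r t :=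
    integral_add hII_lw hII_r
  have hrint : |∫ t in a..b, r t| ≤ 2 * e * (b - a) := by
    have h := norm_integral_le_of_norm_le_const (a := a) (b := b) (f := r) (C := 2 * e)
      fun t ht => by rw [Real.norm_eq_abs]; exact hrb t
    rwa [Real.norm_eq_abs, abs_of_nonneg (sub_nonneg.2 hab)] at h
  have hkey : Ψ (γ b) - Ψ (γ a) - ∫ t in a..b, lam t * w t = ∫ t in a..b, r t := by
    have : (Ψ ∘ γ) b - (Ψ ∘ γ) a = (∫ t in a..b, lam t * w t) + ∫ t in a..b, r t := by
      rw [← hFTC, hint1, hint2]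
    simp only [Function.comp_apply] at this
    linarith
  rw [hkey]
  exact hrint


/-- **Sign-definite comparable weights detect positive variation.**  If `λ` is measurable with
`m ≤ λ ≤ R m` (or `m ≤ −λ ≤ R m`) everywhere, `w` is bounded measurable, `∫_a^b w⁺ ≥ A` and
`∫_a^b w⁻ ≤ B`, then `|∫_a^b λ w| ≥ m A − R m B`. (Elementary.) -/
theorem le_abs_integral_of_sign_definite {lam w : ℝ → ℝ} (hlm : Measurable lam)
    (hwm : Measurable w) {Cw : ℝ} (hwb : ∀ t, |w t| ≤ Cw) {a b m R A B : ℝ} (hab : a ≤ b)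
    (hm : 0 ≤ m) (hR : 0 ≤ R)
    (hsd : (∀ t, m ≤ lam t ∧ lam t ≤ R * m) ∨ (∀ t, m ≤ -lam t ∧ -lam t ≤ R * m))
    (hA : A ≤ ∫ t in a..b, max (w t) 0) (hB : ∫ t in a..b, max (-w t) 0 ≤ B) :
    m * A - R * m * B ≤ |∫ t in a..b, lam t * w t| := by
  have hwp_m : Measurable fun t => max (w t) 0 := hwm.max measurable_const
  have hwm_m : Measurable fun t => max (-w t) 0 := hwm.neg.max measurable_const
  have hwp_b : ∀ t, |max (w t) 0| ≤ Cw := fun t => by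
    rw [abs_of_nonneg (le_max_right _ _)]
    exact max_le ((le_abs_self _).trans (hwb t)) ((abs_nonneg _).trans (hwb t))
  have hwm_b : ∀ t, |max (-w t) 0| ≤ Cw := fun t => by
    rw [abs_of_nonneg (le_max_right _ _)]
    exact max_le ((neg_le_abs _).trans (hwb t)) ((abs_nonneg _).trans (hwb t))
  have key : ∀ l : ℝ → ℝ, Measurable l → (∀ t, m ≤ l t ∧ l t ≤ R * m) →
      m * A - R * m * B ≤ ∫ t in a..b, l t * w t := by
    intro l hl hb
    have hRm : 0 ≤ R * m := mul_nonneg hR hm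
    have hlb : ∀ t, |l t| ≤ R * m := fun t =>
      abs_le.2 ⟨by linarith [(hb t).1], (hb t).2⟩
    have hI : ∀ f : ℝ → ℝ, Measurable f → (∀ t, |f t| ≤ Cw) →
        IntervalIntegrable (fun t => l t * f t) volume a b := fun f hf hfb =>
      intervalIntegrable_of_abs_le (hl.mul hf) hab (C := R * m * Cw) fun t _ => by
        show |l t * f t| ≤ R * m * Cw
        rw [abs_mul]
        exact mul_le_mul (hlb t) (hfb t) (abs_nonneg _) hRm
    have hIp : IntervalIntegrable (fun t => max (w t) 0) volume a b :=
      intervalIntegrable_of_abs_le hwp_m hab fun t _ => hwp_b t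
    have hIm : IntervalIntegrable (fun t => max (-w t) 0) volume a b :=
      intervalIntegrable_of_abs_le hwm_m hab fun t _ => hwm_b t
    have h1 : ∫ t in a..b, l t * w t =
        (∫ t in a..b, l t * max (w t) 0) - ∫ t in a..b, l t * max (-w t) 0 := by
      rw [← integral_sub (hI _ hwp_m hwp_b) (hI _ hwm_m hwm_b)]
      refine integral_congr fun t _ => ?_
      show l t * w t = l t * max (w t) 0 - l t * max (-w t) 0
      rw [← mul_sub, max_zero_sub_max_neg_zero_eq_self]
    have h2 : m * A ≤ ∫ t in a..b, l t * max (w t) 0 :=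
      calc m * A ≤ m * ∫ t in a..b, max (w t) 0 := mul_le_mul_of_nonneg_left hA hm
        _ = ∫ t in a..b, m * max (w t) 0 := (intervalIntegral.integral_const_mul m _).symm
        _ ≤ ∫ t in a..b, l t * max (w t) 0 :=
          integral_mono_on hab ((hIp.const_mul m)) (hI _ hwp_m hwp_b) fun t _ =>
            mul_le_mul_of_nonneg_right (hb t).1 (le_max_right _ _)
    have h3 : ∫ t in a..b, l t * max (-w t) 0 ≤ R * m * B :=
      calc ∫ t in a..b, l t * max (-w t) 0 ≤ ∫ t in a..b, (R * m) * max (-w t) 0 :=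
            integral_mono_on hab (hI _ hwm_m hwm_b) (hIm.const_mul (R * m)) fun t _ =>
              mul_le_mul_of_nonneg_right (hb t).2 (le_max_right _ _)
        _ = (R * m) * ∫ t in a..b, max (-w t) 0 := intervalIntegral.integral_const_mul (R * m) _
        _ ≤ R * m * B := mul_le_mul_of_nonneg_left hB hRm
    linarith
  rcases hsd with h | h
  · exact (key lam hlm h).trans (le_abs_self _)
  · have h1 := key (fun t => -lam t) hlm.neg h
    calc m * A - R * m * B ≤ ∫ t in a..b, (-lam t) * w t := h1
      _ = -∫ t in a..b, lam t * w t := by simp [neg_mul, intervalIntegral.integral_neg]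
      _ ≤ |∫ t in a..b, lam t * w t| := neg_le_abs _

/-- Continuity along a continuous path of a partial derivative of a `C¹` function (bookkeeping). -/
theorem continuous_of_eq_fderiv {Ψ : ℝ × ℝ → ℝ} (hΨ : ContDiff ℝ 1 Ψ) {γ : ℝ → ℝ × ℝ}
    (hγ : Continuous γ) (v : ℝ × ℝ) {G : ℝ → ℝ} (hG : ∀ t, G t = fderiv ℝ Ψ (γ t) v) :
    Continuous G := by
  rw [show G = fun t => fderiv ℝ Ψ (γ t) v from funext hG]
  exact ((hΨ.continuous_fderiv one_ne_zero).comp hγ).clm_apply continuous_const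

end Summit.CriticalPhenomena.CardyFormulaZ2.Theorems.RussoDrift

end
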